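import Summits.CriticalPhenomena.PercolationContinuityZ3.Theorems.Transplant.FKDoubleFanMultifanCone
import Summits.CriticalPhenomena.PercolationContinuityZ3.Theorems.Transplant.FKDoubleFanTwoSidedConeSCrossA
import Summits.CriticalPhenomena.PercolationContinuityZ3.Theorems.Transplant.FKDoubleFanBlocks
import HarnessLib

/-!
# Double fans `K₂ ∨ P_{m+1}`: cross-positivity of `T_a` is AUTOMATIC on the target-, sign- and `C3`-supported part of the boundary of the MULTIFAN₁ cone

Helper file (`--supports stmt-CriticalPhenomena-4575`), FK sub-lane `prim-bschramm-fk-3` (gen 45); builds on p205010 (kernel theorem, internal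
audit signed; external expert review pending).  No named facts, no sorries; standard axioms.  Memo `bschramm/prim-bschramm-fk-3/FAR-CROSS-XX.md` §3f.

`…MultifanConeCross` / `…MultifanSigns` reduce the far cross-apex theorem to `CrossPosA`: at every boundary point `v` of the MULTIFAN₁ cone `coneAB q` and
every supporting dual functional `ρ ∈ DualAB q` with `⟪v, ρ⟫ = 0` one needs `⟪T_a v, ρ⟫ ≥ 0`.  This file isolates the part of that obligation which is
FREE.  The mechanism (**`crossPos_opTa_of_family`**): if the supporting functional belongs to a family that is carried into `DualAB q` (or just into
the functionals non-negative at `v`) by every `a`-spoke — `x ↦ ⟪∧²AC_x v, ρ⟫ ≥ 0` on `[0,1]` with value `0` at `x = 0` — then the derivative at `x = 0`,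
which is `⟪T_a v, ρ⟫ − 2⟪v, ρ⟫ = ⟪T_a v, ρ⟫`, is `≥ 0`.  Instances:
* TARGET faces (**`crossPos_opTa_target`**): `∧²AC_x` of a target is the target of `AC_x ∗ s` (`opAC_target`, `…SesquiCone`), so for every `β` pairing `≥ 0` with all
  targets — in particular every `β ∈ coneAB q` (**`crossPos_opTa_target_of_mem_coneAB`**) — and every target tight at `β`, `⟪T_a β, ω_s⟫ ≥ 0`;
* SIGN faces (**`opTa_coords`**): `T_a` is diagonal with non-negative weights, so a vanishing Plücker coordinate stays `0` under `T_a`;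
* the two oblique facets of the `∧²V₃`-block cone `C3` of `…Blocks` (**`c3_fac_opTa`**, **`c3_tgt_opTa`**): on `{ℓ₃ = 0}` one has `ℓ₃(T_a β) = β_uz ≤ 0` and on
  `{ℓ₄ = 0}` `ℓ₄(T_a β) = −β_yz ≥ 0`; in fact `T_a` maps `C3` into itself outright (**`c3_opTa_mem`**).
CONSEQUENCE for the programme (memo §2i, §3f): numerically the boundary of the MULTIFAN₁ set near generic word planes consists of target faces and sign/`C3` faces,
where `CrossPosA` is therefore automatic; `HypAC` is equivalent to cross-positivity at the REMAINING ("exotic", curved) supporting functionals only.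
[folklore]
-/

noncomputable section

namespace Summit.CriticalPhenomena.PercolationContinuityZ3.Theorems

namespace FK

namespace ThreeApex

/-! ### The mechanism: an `a`-stable family of non-negative functionals gives cross-positivity for free -/

/-- **Cross-positivity from an `a`-stable family.**  If `x ↦ ⟪∧²AC_x β, ρ⟫` is `≥ 0` on `[0,1]` and vanishes at `x = 0`, then `⟪T_a β, ρ⟫ ≥ 0`
(its value is the right derivative at `0` of that function, up to the term `−2⟪β,ρ⟫ = 0`). [folklore] -/
theorem crossPos_opTa_of_family {q : ℝ} {β ρ : Biv} (h : ∀ x : ℝ, 0 ≤ x → x ≤ 1 → 0 ≤ pairH q (opAC x β) ρ) (h0 : pairH q β ρ = 0) :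
    0 ≤ pairH q (opTa β) ρ := by
  set T := pairH q (opTa β) ρ with hT
  set W := pairH q (opWa β) ρ with hW
  have key : ∀ x : ℝ, 0 < x → x ≤ 1 → 0 ≤ (1 - x) * T + x * W := by
    intro x hx0 hx1
    have hx := h x hx0.le hx1
    rw [pairH_opAC_poly, h0, mul_zero, zero_add] at hx
    have e : x * (1 - x) * T + x ^ 2 * W = x * ((1 - x) * T + x * W) := by ring
    rw [e] at hx
    by_contra H
    push Not at H
    nlinarith [mul_pos hx0 (neg_pos.mpr H), hx]
  by_contra hA
  push Not at hA
  -- along `x = 1/(n+2)`: `(n+1)·T + W ≥ 0` for every `n`, impossible for `T < 0`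
  obtain ⟨n, hn⟩ := exists_nat_gt (W / -T)
  have hx0 : (0 : ℝ) < 1 / ((n : ℝ) + 2) := by positivity
  have hx1 : 1 / ((n : ℝ) + 2) ≤ 1 := by
    rw [div_le_one (by positivity)]; linarith [n.cast_nonneg (α := ℝ)]
  have k := key _ hx0 hx1
  have hk : 0 ≤ ((n : ℝ) + 1) * T + W := by
    have e : ((n : ℝ) + 2) * ((1 - 1 / ((n : ℝ) + 2)) * T + 1 / ((n : ℝ) + 2) * W) = ((n : ℝ) + 1) * T + W := by
      field_simp
      ring
    rw [← e]; exact mul_nonneg (by positivity) k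
  have hB : W < n * -T := by rwa [div_lt_iff₀ (neg_pos.mpr hA)] at hn
  nlinarith [hk, hB, hA, n.cast_nonneg (α := ℝ)]

/-! ### Target faces -/

/-- **Cross-positivity at TARGET faces is automatic**: if `β` pairs `≥ 0` with every target (`s ∈ InKE q`) and the target of `s` is tight at `β`, then
`⟪T_a β, (s∗BC_0)∧(s∗BC_1)⟫ ≥ 0`. [folklore] -/
theorem crossPos_opTa_target {q : ℝ} {β : Biv} (hβ : ∀ s' : V5, InKE q s' → 0 ≤ pairH q β (wedgeH (conv s' (edgeBC 0)) (conv s' (edgeBC 1))))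
    {s : V5} (hs : InKE q s) (h0 : pairH q β (wedgeH (conv s (edgeBC 0)) (conv s (edgeBC 1))) = 0) :
    0 ≤ pairH q (opTa β) (wedgeH (conv s (edgeBC 0)) (conv s (edgeBC 1))) := by
  refine crossPos_opTa_of_family (fun x hx0 hx1 => ?_) h0
  rw [pairH_opAC, opAC_target]
  exact hβ _ (InKE.step (IsLetter.ac hx0 hx1) hs)

/-- In particular at every point of the MULTIFAN₁ cone (`0 < q ≤ 1`): the target-supported part of `CrossPosA` holds unconditionally. [folklore] -/
theorem crossPos_opTa_target_of_mem_coneAB {q : ℝ} (hq0 : 0 < q) (hq1 : q ≤ 1) {β : Biv} (hβ : β ∈ coneAB q) {s : V5} (hs : InKE q s)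
    (h0 : pairH q β (wedgeH (conv s (edgeBC 0)) (conv s (edgeBC 1))) = 0) :
    0 ≤ pairH q (opTa β) (wedgeH (conv s (edgeBC 0)) (conv s (edgeBC 1))) :=
  crossPos_opTa_target (fun _ hs' => pairH_coneAB_target hq0 hq1 hs' β hβ) hs h0

/-! ### Sign faces and the facets of `C3` -/

/-- `T_a` is diagonal with non-negative weights (`0` on `ux,uz,xz`; `1` on `uy,uv,xy,xv,yz,zv`; `2` on `yv`): a vanishing Plücker coordinate stays zero —
cross-positivity at SIGN faces is automatic. [folklore] -/
theorem opTa_coords (β : Biv) :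
    (opTa β).ux = 0 ∧ (opTa β).uy = β.uy ∧ (opTa β).uz = 0 ∧ (opTa β).uv = β.uv ∧ (opTa β).xy = β.xy ∧ (opTa β).xz = 0 ∧
      (opTa β).xv = β.xv ∧ (opTa β).yz = β.yz ∧ (opTa β).yv = 2 * β.yv ∧ (opTa β).zv = β.zv :=
  ⟨rfl, rfl, rfl, rfl, rfl, rfl, rfl, rfl, rfl, rfl⟩

/-- **`T_a` maps the `∧²V₃`-block cone `C3` into itself** (`q ≤ 2`): all four facet functionals stay `≥ 0`. [folklore] -/
theorem c3_opTa_mem {q : ℝ} (hq : q ≤ 2) {β : Biv} (h : C3 q β) : C3 q (opTa β) := by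
  obtain ⟨h1, h2, h3, h4⟩ := h
  refine ⟨?_, ?_, ?_, ?_⟩ <;> simp only [opTa]
  · exact h1
  · exact le_refl 0
  · linarith
  · have : 0 ≤ 2 - q := by linarith
    nlinarith

/-- On the facet `{ℓ₃ = 0}` of `C3`: `ℓ₃(T_a β) = −β_uz ≥ 0`, i.e. `(T_aβ)_uy − (T_aβ)_uz + (T_aβ)_yz = β_uz ≤ 0`. [folklore] -/
theorem c3_fac_opTa {q : ℝ} {β : Biv} (h : C3 q β) (h0 : β.uy - β.uz + β.yz = 0) :
    (opTa β).uy - (opTa β).uz + (opTa β).yz = β.uz ∧ β.uz ≤ 0 := by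
  refine ⟨?_, h.uz⟩
  simp only [opTa]; linarith

/-- On the facet `{ℓ₄ = 0}` of `C3`: `ℓ₄(T_a β) = −β_yz ≥ 0`. [folklore] -/
theorem c3_tgt_opTa {q : ℝ} (hq : q ≤ 2) {β : Biv} (h : C3 q β) (h0 : (2 - q) * β.uz - β.yz = 0) :
    (2 - q) * (opTa β).uz - (opTa β).yz = -β.yz ∧ 0 ≤ -β.yz := by
  refine ⟨by simp only [opTa]; ring, ?_⟩
  have h2 := h.uz
  have : 0 ≤ 2 - q := by linarith
  nlinarith [h0]

end ThreeApex

end FK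

end Summit.CriticalPhenomena.PercolationContinuityZ3.Theorems
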